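import Literature.MeasureTheory.Hausdorff.SphereCapAsymptotics
import HarnessLib

/-!
# Route `CylinderEntropy`, item `ImmortalAreaToFloor` (stmt-SmoothPoincare4-17197):
# Gaussian mass of caps of `S⁴` — the abstract layer-cake comparison and the cap/disc transfer

Brick (KM, spherical half) of the Allard-free blueprint for the residual `ThinSeq` of the item (evidence
`ANALYSIS-prover-17197-c1.md`, §6, CASE 0): the typed cylinder density integrates the zonal heat kernel of `S⁴`, which
by the tree's PROVED Cheeger–Yau bound dominates a CHORDAL Gaussian `y ↦ e^{-b ‖y - x‖²}` on the cap around the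
centre `x`; the mass of that Gaussian on a cap, and on a subset dense in every centred cap, is what CASE 0 needs.
This file PROVES, for Mathlib's un-normalised Hausdorff measure `μH[4]`:

* `lintegral_ge_of_superlevel_balls` — **abstract layer-cake comparison**: two measures `μ, ν` on two spaces,
  two non-negative measurable functions `f, g` and two families of "balls" such that, inside the reference sets
  `B, B'`, the super-level sets `{t < f} ∩ B` and `{t < g} ∩ B'` are balls OF THE SAME RADIUS `ρ(t) ≤ R`, and
  `C · ν(ball' ρ) ≤ μ(ball ρ)` for `ρ ≤ R`; then `C ∫⁻_{B'} g dν ≤ ∫⁻_B f dμ` (`lintegral_eq_lintegral_meas_lt` on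
  both sides).  Specialisations: a set dense in every centred ball (`μ = ν⌊G`-type use), and the cap/disc transfer;
* `lt_exp_neg_mul_sq_iff`, `exists_superlevel_cap_and_ball` — the super-level sets of the chordal Gaussian inside
  the cap `S⁴ ∩ B(x,R)`, resp. of the radial Gaussian inside the disc `B⁴(0,R)`, are the cap, resp. disc, of the SAME
  radius `min R √(-log t / b)` (and everything / nothing for `t ≤ 0` / `t ≥ 1`);
* **`mul_lintegral_ball_le_lintegral_cap`** — for `x ∈ S⁴ ⊂ ℝ⁵`, `0 < R`, `R² < 2`, `b > 0`:
  `(1 - R²/4)² ∫⁻_{B⁴(0,R)} e^{-b‖z‖²} dμH[4] ≤ ∫⁻_{S⁴ ∩ B(x,R)} e^{-b‖y-x‖²} dμH[4](y)`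
  (pointwise input: the tree's cap/disc comparison `mul_hausdorffMeasure_ball_le_unitSphere_inter_ball`);
* **`mul_lintegral_cap_le_lintegral_inter_cap`** — if `G ⊆ ℝ⁵` has `(1-θ) μH[4](S⁴ ∩ B(x,ρ)) ≤ μH[4](G ∩ S⁴ ∩ B(x,ρ))`
  for all `ρ ∈ (0,R]`, then `(1-θ) ∫⁻_{S⁴ ∩ B(x,R)} e^{-b‖y-x‖²} ≤ ∫⁻_{G ∩ (S⁴ ∩ B(x,R))} e^{-b‖y-x‖²}`.

Everything is proved; no definition, no named fact.

References: layer-cake formula (E. H. Lieb, M. Loss, *Analysis*, Thm. 1.13); H. Federer, *Geometric Measure Theory*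
(1969), 3.2.19 (caps of spheres).
-/

noncomputable section

-- the prescribed namespace `Summit.SmoothPoincare4.SmoothPoincare4.…` repeats `SmoothPoincare4`
set_option linter.dupNamespace false

open MeasureTheory Set Filter Real Metric
open scoped ENNReal NNReal Topology BigOperators

namespace Summit.SmoothPoincare4.SmoothPoincare4.Theorems.GaussianMass

/-! ## The abstract layer-cake comparison -/

/-- **Abstract layer-cake comparison.** Let `f ≥ 0` on `(α, μ)` and `g ≥ 0` on `(β, ν)` be measurable, `B ⊆ α`,
`B' ⊆ β`, and `ballα, ballβ : ℝ → Set` families such that for every level `t` ONE radius `ρ ∈ [0, R]` cuts out both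
super-level sets, `{t < f} ∩ B = ballα ρ` and `{t < g} ∩ B' = ballβ ρ`, and such that `C · ν (ballβ ρ) ≤ μ (ballα ρ)`
for all `ρ ∈ [0, R]`.  Then `C · ∫⁻_{B'} g dν ≤ ∫⁻_B f dμ`. (Layer cake on both sides, `lintegral_eq_lintegral_meas_lt`,
and the pointwise-in-`t` comparison.) [cite: LiebLoss2001, Thm. 1.13] -/
theorem lintegral_ge_of_superlevel_balls {α β : Type*} [MeasurableSpace α] [MeasurableSpace β]
    {μ : Measure α} {ν : Measure β} {f : α → ℝ} {g : β → ℝ} (hf : Measurable f) (hg : Measurable g)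
    (hf0 : ∀ a, 0 ≤ f a) (hg0 : ∀ b, 0 ≤ g b) {B : Set α} {B' : Set β}
    {ballα : ℝ → Set α} {ballβ : ℝ → Set β} {R : ℝ} {C : ℝ≥0∞}
    (hlevel : ∀ t : ℝ, ∃ ρ : ℝ, 0 ≤ ρ ∧ ρ ≤ R ∧ {a | t < f a} ∩ B = ballα ρ ∧ {b | t < g b} ∩ B' = ballβ ρ)
    (hcomp : ∀ ρ : ℝ, 0 ≤ ρ → ρ ≤ R → C * ν (ballβ ρ) ≤ μ (ballα ρ)) :
    C * ∫⁻ b in B', ENNReal.ofReal (g b) ∂ν ≤ ∫⁻ a in B, ENNReal.ofReal (f a) ∂μ := by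
  have hflev : ∀ t : ℝ, MeasurableSet {a | t < f a} := fun t => measurableSet_lt measurable_const hf
  have hglev : ∀ t : ℝ, MeasurableSet {b | t < g b} := fun t => measurableSet_lt measurable_const hg
  rw [lintegral_eq_lintegral_meas_lt _ (Eventually.of_forall hf0) hf.aemeasurable,
    lintegral_eq_lintegral_meas_lt _ (Eventually.of_forall hg0) hg.aemeasurable, ← lintegral_const_mul _ ?_]
  swap
  · exact Antitone.measurable (fun s t hst => measure_mono fun b (hb : t < _) => lt_of_le_of_lt hst hb)
  refine lintegral_mono fun t => ?_
  obtain ⟨ρ, hρ0, hρR, hα, hβ⟩ := hlevel t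
  rw [Measure.restrict_apply (hflev t), Measure.restrict_apply (hglev t), hα, hβ]
  exact hcomp ρ hρ0 hρR

/-! ## Super-level sets of the chordal / radial Gaussian -/

/-- The level radius of the Gaussian `e^{-b s²}` at height `t`: for `b > 0`, `0 < t < 1` and `s ≥ 0`,
`t < e^{-b s²} ↔ s < √(-log t / b)`. [folklore] -/
theorem lt_exp_neg_mul_sq_iff {b t : ℝ} (hb : 0 < b) (ht : 0 < t) (ht1 : t < 1) {s : ℝ} (hs : 0 ≤ s) :
    t < exp (-b * s ^ 2) ↔ s < √(-log t / b) := by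
  have hlogt : 0 < -log t := by rw [neg_pos]; exact log_neg ht ht1
  have hρ0 : 0 ≤ √(-log t / b) := sqrt_nonneg _
  have hρsq : √(-log t / b) ^ 2 = -log t / b := sq_sqrt (div_nonneg hlogt.le hb.le)
  rw [← log_lt_iff_lt_exp ht, ← pow_lt_pow_iff_left₀ hs hρ0 two_ne_zero, hρsq, lt_div_iff₀ hb]
  constructor <;> intro h <;> nlinarith

/-- **Joint level structure of the chordal Gaussian on a cap of `S⁴` and the radial Gaussian on the `4`-disc**: for
every level `t` one radius `ρ ∈ [0, R]` cuts out both super-level sets. [folklore] -/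
theorem exists_superlevel_cap_and_ball {b R : ℝ} (hb : 0 < b) (hR : 0 ≤ R) (x : EuclideanSpace ℝ (Fin 5))
    (t : ℝ) :
    ∃ ρ : ℝ, 0 ≤ ρ ∧ ρ ≤ R ∧
      {y : EuclideanSpace ℝ (Fin 5) | t < exp (-b * ‖y - x‖ ^ 2)} ∩ (sphere (0 : EuclideanSpace ℝ (Fin 5)) 1 ∩ ball x R) =
        sphere (0 : EuclideanSpace ℝ (Fin 5)) 1 ∩ ball x ρ ∧
      {z : EuclideanSpace ℝ (Fin 4) | t < exp (-b * ‖z‖ ^ 2)} ∩ ball (0 : EuclideanSpace ℝ (Fin 4)) R =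
        ball (0 : EuclideanSpace ℝ (Fin 4)) ρ := by
  rcases le_or_gt t 0 with ht | ht
  · -- everything
    refine ⟨R, hR, le_rfl, ?_, ?_⟩
    · ext y
      simp only [mem_inter_iff, mem_setOf_eq, and_iff_right_iff_imp]
      exact fun _ => lt_of_le_of_lt ht (exp_pos _)
    · ext z
      simp only [mem_inter_iff, mem_setOf_eq, and_iff_right_iff_imp]
      exact fun _ => lt_of_le_of_lt ht (exp_pos _)
  rcases le_or_gt 1 t with ht1 | ht1
  · -- nothing
    have hle : ∀ s : ℝ, exp (-b * s ^ 2) ≤ t := fun s =>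
      calc exp (-b * s ^ 2) ≤ exp 0 := exp_le_exp.2 (by nlinarith [sq_nonneg s])
        _ = 1 := exp_zero
        _ ≤ t := ht1
    refine ⟨0, le_rfl, hR, ?_, ?_⟩
    · rw [ball_zero, inter_empty]
      ext y
      simp only [mem_inter_iff, mem_setOf_eq, mem_empty_iff_false, iff_false, not_and]
      exact fun h => absurd h (not_lt.2 (hle _))
    · rw [ball_zero]
      ext z
      simp only [mem_inter_iff, mem_setOf_eq, mem_empty_iff_false, iff_false, not_and]
      exact fun h => absurd h (not_lt.2 (hle _))
  -- `0 < t < 1`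
  set ρ : ℝ := √(-log t / b) with hρ
  have hρ0 : 0 ≤ ρ := sqrt_nonneg _
  refine ⟨min R ρ, le_min hR hρ0, min_le_left _ _, ?_, ?_⟩
  · ext y
    simp only [mem_inter_iff, mem_setOf_eq, mem_ball, dist_eq_norm, lt_min_iff,
      lt_exp_neg_mul_sq_iff hb ht ht1 (norm_nonneg (y - x))]
    tauto
  · ext z
    simp only [mem_inter_iff, mem_setOf_eq, mem_ball, dist_zero_right, lt_min_iff,
      lt_exp_neg_mul_sq_iff hb ht ht1 (norm_nonneg z)]
    tauto

/-! ## The cap/disc transfer and dense subsets of caps -/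

/-- **Gaussian mass of a cap of `S⁴` against the flat `4`-disc.** For `x ∈ S⁴ ⊂ ℝ⁵`, `0 < R`, `R² < 2` and `b > 0`:
`(1 - R²/4)² ∫⁻_{B⁴(0,R)} e^{-b‖z‖²} dμH[4] ≤ ∫⁻_{S⁴ ∩ B(x,R)} e^{-b‖y - x‖²} dμH[4](y)` — the abstract layer-cake
comparison with the tree's cap/disc comparison `mul_hausdorffMeasure_ball_le_unitSphere_inter_ball` at every radius
`ρ ≤ R` (and `(1-ρ²/4)² ≥ (1-R²/4)²`). [cite: Federer1969, 3.2.19] -/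
theorem mul_lintegral_ball_le_lintegral_cap {x : EuclideanSpace ℝ (Fin 5)} (hx : ‖x‖ = 1) {R b : ℝ} (hR : 0 < R)
    (hR2 : R ^ 2 < 2) (hb : 0 < b) :
    ENNReal.ofReal ((1 - R ^ 2 / 4) ^ 2) *
        ∫⁻ z in ball (0 : EuclideanSpace ℝ (Fin 4)) R, ENNReal.ofReal (exp (-b * ‖z‖ ^ 2)) ∂μH[4] ≤
      ∫⁻ y in sphere (0 : EuclideanSpace ℝ (Fin 5)) 1 ∩ ball x R, ENNReal.ofReal (exp (-b * ‖y - x‖ ^ 2)) ∂μH[4] := by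
  have hf : Measurable fun y : EuclideanSpace ℝ (Fin 5) => exp (-b * ‖y - x‖ ^ 2) :=
    (continuous_exp.comp (continuous_const.mul ((continuous_id.sub continuous_const).norm.pow 2))).measurable
  have hg : Measurable fun z : EuclideanSpace ℝ (Fin 4) => exp (-b * ‖z‖ ^ 2) :=
    (continuous_exp.comp (continuous_const.mul (continuous_norm.pow 2))).measurable
  refine lintegral_ge_of_superlevel_balls (μ := μH[4]) (ν := μH[4]) hf hg (fun _ => (exp_pos _).le)
    (fun _ => (exp_pos _).le) (ballα := fun ρ => sphere (0 : EuclideanSpace ℝ (Fin 5)) 1 ∩ ball x ρ)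
    (ballβ := fun ρ => ball (0 : EuclideanSpace ℝ (Fin 4)) ρ)
    (fun t => exists_superlevel_cap_and_ball hb hR.le x t) fun ρ hρ0 hρR => ?_
  rcases eq_or_lt_of_le hρ0 with h0 | hρ
  · simp [← h0]
  have hρ2 : ρ ^ 2 < 2 := lt_of_le_of_lt (by nlinarith) hR2
  have hE : Module.finrank ℝ (EuclideanSpace ℝ (Fin 5)) = 4 + 1 := finrank_euclideanSpace_fin
  have hcap : ENNReal.ofReal (√(1 - ρ ^ 2 / 4) ^ 4) * μH[4] (ball (0 : EuclideanSpace ℝ (Fin 4)) ρ) ≤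
      μH[4] (sphere (0 : EuclideanSpace ℝ (Fin 5)) 1 ∩ ball x ρ) := by
    simpa using Literature.MeasureTheory.Hausdorff.mul_hausdorffMeasure_ball_le_unitSphere_inter_ball hE
      (by norm_num) hx hρ hρ2
  refine le_trans ?_ hcap
  gcongr
  -- `(1 - R²/4)² ≤ (√(1 - ρ²/4))⁴ = (1 - ρ²/4)²`
  have h1 : 0 ≤ 1 - ρ ^ 2 / 4 := by nlinarith
  have h2 : √(1 - ρ ^ 2 / 4) ^ 4 = (1 - ρ ^ 2 / 4) ^ 2 := by
    rw [show (4 : ℕ) = 2 * 2 from rfl, pow_mul, sq_sqrt h1]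
  rw [h2]
  have h3 : 1 - R ^ 2 / 4 ≤ 1 - ρ ^ 2 / 4 := by nlinarith
  have h4 : 0 ≤ 1 - R ^ 2 / 4 := by nlinarith
  exact pow_le_pow_left₀ h4 h3 2

/-- **A subset dense in every centred cap carries its share of the Gaussian mass.** If `G ⊆ ℝ⁵` satisfies
`(1-θ) μH[4](S⁴ ∩ B(x,ρ)) ≤ μH[4](G ∩ (S⁴ ∩ B(x,ρ)))` for every `ρ ∈ (0, R]`, then
`(1-θ) ∫⁻_{S⁴ ∩ B(x,R)} e^{-b‖y-x‖²} dμH[4] ≤ ∫⁻_{G ∩ (S⁴ ∩ B(x,R))} e^{-b‖y-x‖²} dμH[4]` (`b > 0`, `R > 0`; no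
measurability of `G` is needed). [cite: LiebLoss2001, Thm. 1.13] -/
theorem mul_lintegral_cap_le_lintegral_inter_cap {x : EuclideanSpace ℝ (Fin 5)} {R b θ : ℝ} (hR : 0 < R)
    (hb : 0 < b) {G : Set (EuclideanSpace ℝ (Fin 5))}
    (hdense : ∀ ρ : ℝ, 0 < ρ → ρ ≤ R →
      ENNReal.ofReal (1 - θ) * μH[4] (sphere (0 : EuclideanSpace ℝ (Fin 5)) 1 ∩ ball x ρ) ≤
        μH[4] (G ∩ (sphere (0 : EuclideanSpace ℝ (Fin 5)) 1 ∩ ball x ρ))) :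
    ENNReal.ofReal (1 - θ) *
        ∫⁻ y in sphere (0 : EuclideanSpace ℝ (Fin 5)) 1 ∩ ball x R, ENNReal.ofReal (exp (-b * ‖y - x‖ ^ 2)) ∂μH[4] ≤
      ∫⁻ y in G ∩ (sphere (0 : EuclideanSpace ℝ (Fin 5)) 1 ∩ ball x R),
        ENNReal.ofReal (exp (-b * ‖y - x‖ ^ 2)) ∂μH[4] := by
  have hf : Measurable fun y : EuclideanSpace ℝ (Fin 5) => exp (-b * ‖y - x‖ ^ 2) :=
    (continuous_exp.comp (continuous_const.mul ((continuous_id.sub continuous_const).norm.pow 2))).measurable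
  refine lintegral_ge_of_superlevel_balls (μ := μH[4]) (ν := μH[4]) hf hf (fun _ => (exp_pos _).le)
    (fun _ => (exp_pos _).le)
    (ballα := fun ρ => G ∩ (sphere (0 : EuclideanSpace ℝ (Fin 5)) 1 ∩ ball x ρ))
    (ballβ := fun ρ => sphere (0 : EuclideanSpace ℝ (Fin 5)) 1 ∩ ball x ρ) (R := R)
    (fun t => ?_) fun ρ hρ0 hρR => ?_
  · obtain ⟨ρ, hρ0, hρR, hcap, -⟩ := exists_superlevel_cap_and_ball hb hR.le x t
    refine ⟨ρ, hρ0, hρR, ?_, hcap⟩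
    rw [inter_left_comm, hcap]
  · rcases eq_or_lt_of_le hρ0 with h0 | hρ
    · simp [← h0]
    · exact hdense ρ hρ hρR

end Summit.SmoothPoincare4.SmoothPoincare4.Theorems.GaussianMass

end
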